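import Literature.AlgebraicGeometry.Frobenioids.PerfectionOps
import Literature.AlgebraicGeometry.Frobenioids.ModelFrobenioidPreFrobenioid
import HarnessLib

/-!
# Frobenioids I, Prop. 5.5 (iv) for `C^pf` of a model Frobenioid, I: the unit component `u^pf` of a
# perfected morphism

Mochizuki, *The geometry of Frobenioids I: the general theory*, Kyushu J. Math. **62** (2008)
293–400, Theorem 5.2 (i) p. 100 (the model Frobenioid of `(Φ, B, Div_B)`: morphisms
`φ = (deg_Fr(φ), Base(φ), Div(φ), u_φ)`), Definition 3.1 (ii)/(iii) pp. 56–57 (`C^pf`) and Proposition 5.5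
(iv) p. 104: "If `C` is the model Frobenioid associated to data `Φ, B, Div_B : B → Φ^gp`, then there is a
natural equivalence of categories … between `C^pf` … and the model Frobenioid associated to the data
`Φ^pf, B^pf, B^pf → (Φ^gp)^pf`" [cite: MochizukiFrdI2008, Prop. 5.5 (iv) p.104].

Sub-node FrdI:Prop5.5(iv)/P55-L08, `C^pf` row (slot `FrdI.Prop55Sub.Prop55iv_pf`), FIRST PART.  Print: "(iv) is
immediate from the definitions"; made explicit, the comparison functor `C^pf → (model of the perfected data)`
sends `((A_D, α), n) ↦ (A_D, α^{1/n})` and a perfected morphism, represented at level `(a, b)` by an arrow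
`θ : A^{(a)} → A'^{(b)}` of `C`, to `(deg_Fr(θ), Base, Div^pf, u^pf)` where `Base`, `deg_Fr`, `Div^pf` are those of
Prop. 3.2 (i) (`PerfectionOps.lean`) and the UNIT component is

  `u^pf := ( Base(frob_A)^* u_θ · u_{frob_A}^{deg θ} · (Base^* u_{frob_A'})⁻¹ )^{1/(n·a)} ∈ B^pf(A_D)`

(`unitB`, `unitPf`; `B` is group-like, so the inverse exists, `IsGroupLike.inv`).  This file proves that
`u^pf` is independent of the representative (transport to a higher level raises the bracket to the
corresponding power, `unitB_lift`; `Hom.unitPf`) and satisfies the unit laws of a model Frobenioid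
(`unitPf_comp`, `unitPf_id`).  Only `hF : IsFrobenioid (toElem Φ B DivB)` and group-likeness of `B` are used.
-/

namespace Literature.AlgebraicGeometry.Frobenioids

open CategoryTheory Opposite

universe w v u

/-! ### Inverses in a group-like commutative monoid -/

namespace IsGroupLike

variable {M N : Type w} [CommMonoid M] [CommMonoid N]

/-- The inverse of an element of a group-like commutative monoid (every element is a unit, Def. 1.1 (i)).
[cite: MochizukiFrdI2008, Def. 1.1 (i) p.19] -/
noncomputable def inv (hM : IsGroupLike M) (b : M) : M := ↑(hM.isUnit b).unit⁻¹

/-- `b · b⁻¹ = 1`. [cite: MochizukiFrdI2008, Def. 1.1 (i) p.19] -/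
theorem mul_inv (hM : IsGroupLike M) (b : M) : b * hM.inv b = 1 := (hM.isUnit b).mul_val_inv

/-- `b⁻¹ · b = 1`. [cite: MochizukiFrdI2008, Def. 1.1 (i) p.19] -/
theorem inv_mul (hM : IsGroupLike M) (b : M) : hM.inv b * b = 1 := (hM.isUnit b).val_inv_mul

/-- Uniqueness of inverses. [cite: MochizukiFrdI2008, Def. 1.1 (i) p.19] -/
theorem inv_unique (hM : IsGroupLike M) {b c : M} (h : b * c = 1) : c = hM.inv b := by
  calc c = hM.inv b * b * c := by rw [hM.inv_mul, one_mul]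
    _ = hM.inv b := by rw [mul_assoc, h, mul_one]

/-- `(a b)⁻¹ = a⁻¹ b⁻¹`. [cite: MochizukiFrdI2008, Def. 1.1 (i) p.19] -/
theorem inv_mul_distrib (hM : IsGroupLike M) (a b : M) : hM.inv (a * b) = hM.inv a * hM.inv b :=
  (hM.inv_unique (by rw [mul_mul_mul_comm, hM.mul_inv, hM.mul_inv, mul_one])).symm

/-- `(a^k)⁻¹ = (a⁻¹)^k`. [cite: MochizukiFrdI2008, Def. 1.1 (i) p.19] -/
theorem inv_pow (hM : IsGroupLike M) (a : M) (k : ℕ) : hM.inv (a ^ k) = hM.inv a ^ k :=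
  (hM.inv_unique (by rw [← mul_pow, hM.mul_inv, one_pow])).symm

/-- `1⁻¹ = 1`. [cite: MochizukiFrdI2008, Def. 1.1 (i) p.19] -/
theorem inv_one (hM : IsGroupLike M) : hM.inv 1 = 1 := (hM.inv_unique (mul_one 1)).symm

/-- `(a⁻¹)⁻¹ = a`. [cite: MochizukiFrdI2008, Def. 1.1 (i) p.19] -/
theorem inv_inv (hM : IsGroupLike M) (a : M) : hM.inv (hM.inv a) = a :=
  (hM.inv_unique (hM.inv_mul a)).symm

/-- Homomorphisms preserve inverses. [cite: MochizukiFrdI2008, Def. 1.1 (i) p.19] -/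
theorem map_inv (hM : IsGroupLike M) (hN : IsGroupLike N) (f : M →* N) (a : M) :
    f (hM.inv a) = hN.inv (f a) :=
  hN.inv_unique (by rw [← map_mul, hM.mul_inv, map_one])

/-- A homomorphism into a group takes `a⁻¹` to `(f a)⁻¹`. [cite: MochizukiFrdI2008, Def. 1.1 (i) p.19] -/
theorem map_inv_eq_inv {G : Type w} [CommGroup G] (hM : IsGroupLike M) (f : M →* G) (a : M) :
    f (hM.inv a) = (f a)⁻¹ :=
  eq_inv_of_mul_eq_one_right (by rw [← map_mul, hM.mul_inv, map_one])

/-- Cancellation of a unit on the right: `x · b = y · b → x = y`. [cite: MochizukiFrdI2008, Def. 1.1 (i) p.19] -/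
theorem mul_right_cancel (hM : IsGroupLike M) {x y : M} (b : M) (h : x * b = y * b) : x = y :=
  (hM.isUnit b).mul_left_inj.mp h

end IsGroupLike

/-! ### Model Frobenioids: two dictionary facts -/

namespace ModelFrobenioid

variable {D : Type u} [Category.{v} D] {Φ B : Dᵒᵖ ⥤ CommMonCat.{w}} {DivB : B ⟶ monoidGp Φ}

/-- A morphism of Frobenius type of the model Frobenioid has `Div = 0` (it is an isometry).
[cite: MochizukiFrdI2008, Thm. 5.2 (ii) p.100] -/
theorem div_eq_one_of_isFrobeniusType {X Y : ModelFrobenioid Φ B DivB} {φ : X ⟶ Y}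
    (hφ : PreFrobenioid.IsFrobeniusType (toElem Φ B DivB) φ) : div φ = 1 := hφ.1.2

/-- A morphism of Frobenius type of the model Frobenioid has invertible `Base`.
[cite: MochizukiFrdI2008, Thm. 5.2 (ii) p.100] -/
theorem isIso_baseMap_of_isFrobeniusType {X Y : ModelFrobenioid Φ B DivB} {φ : X ⟶ Y}
    (hφ : PreFrobenioid.IsFrobeniusType (toElem Φ B DivB) φ) : IsIso (baseMap φ) := hφ.2

/-- The units along a Frobenius-conjugation square `α ≫ φ' = φ ≫ β` of the model Frobenioid:
`Base(α)^* u_{φ'} · u_α^{deg φ'} = Base(φ)^* u_β · u_φ^{deg β}`. [cite: MochizukiFrdI2008, Thm. 5.2 (i) p.100] -/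
theorem unit_square {X Y X' Y' : ModelFrobenioid Φ B DivB} {φ : X ⟶ Y} {α : X ⟶ X'} {β : Y ⟶ Y'}
    {φ' : X' ⟶ Y'} (h : α ≫ φ' = φ ≫ β) :
    pull B (baseMap α) (unit φ') * unit α ^ (degFr φ' : ℕ) = pull B (baseMap φ) (unit β) * unit φ ^ (degFr β : ℕ) := by
  have := congrArg unit h
  rwa [unit_comp, unit_comp] at this

end ModelFrobenioid

/-! ### The unit component of a perfected morphism of a model Frobenioid -/

namespace PreFrobenioid

namespace Perfection

namespace ModelPf

variable {D : Type u} [Category.{v} D] {Φ B : Dᵒᵖ ⥤ CommMonCat.{w}} {DivB : B ⟶ monoidGp Φ}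
  {hF : IsFrobenioid (ModelFrobenioid.toElem Φ B DivB)} {X Y Z : Perfection hF}

/-- The chosen Frobenius arrow `frob_A : A → A^{(a)}` of the model Frobenioid has invertible `Base`.
[cite: MochizukiFrdI2008, Def. 1.3 (ii) p.24] -/
theorem isIso_baseMap_frob (A : ModelFrobenioid Φ B DivB) (a : ℕ+) :
    IsIso (ModelFrobenioid.baseMap (frob hF A a)) :=
  ModelFrobenioid.isIso_baseMap_of_isFrobeniusType (isFrobeniusType_frob hF A a)

variable (X Y) in
/-- `Base` of a representative, typed over the model base objects `A_D → A'_D`.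
[cite: MochizukiFrdI2008, Prop. 3.2 (i) p.58] -/
noncomputable abbrev Rep.mbase (r : Rep X Y) : X.obj.base ⟶ Y.obj.base := r.baseMap

/-- `Base` of a perfected morphism, typed over the model base objects.
[cite: MochizukiFrdI2008, Prop. 3.2 (i) p.58] -/
noncomputable abbrev Hom.mbase (f : X ⟶ Y) : X.obj.base ⟶ Y.obj.base := Hom.baseMap f

/-- `Base(r) ≫ Base(frob_{A'}) = Base(frob_A) ≫ Base(θ)`. [cite: MochizukiFrdI2008, Prop. 3.2 (i) p.58] -/
theorem mbase_comp (r : Rep X Y) :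
    Rep.mbase X Y r ≫ ModelFrobenioid.baseMap (frob hF Y.obj r.L.b) =
      ModelFrobenioid.baseMap (frob hF X.obj r.L.a) ≫ ModelFrobenioid.baseMap r.hom := by
  haveI := isIso_baseMap_frob (hF := hF) Y.obj r.L.b
  change (ModelFrobenioid.baseMap (frob hF X.obj r.L.a) ≫ ModelFrobenioid.baseMap r.hom ≫
      CategoryTheory.inv (ModelFrobenioid.baseMap (frob hF Y.obj r.L.b))) ≫ ModelFrobenioid.baseMap (frob hF Y.obj r.L.b) = _
  rw [Category.assoc, Category.assoc, IsIso.inv_hom_id, Category.comp_id]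

/-- Pulling back twice along the square `Base(r) ≫ Base(frob_{A'}) = Base(frob_A) ≫ Base(θ)`.
[cite: MochizukiFrdI2008, Prop. 3.2 (i) p.58] -/
theorem pull_mbase_pull (r : Rep X Y) (x : B.obj (op (frobPow hF Y.obj r.L.b).base)) :
    pull B (Rep.mbase X Y r) (pull B (ModelFrobenioid.baseMap (frob hF Y.obj r.L.b)) x) =
      pull B (ModelFrobenioid.baseMap (frob hF X.obj r.L.a)) (pull B (ModelFrobenioid.baseMap r.hom) x) := by
  rw [← pull_comp, ← pull_comp, mbase_comp]

variable (hB : Objectwise (fun M _ => IsGroupLike M) B)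

/-- **The unit component (before taking roots)** of a representative `θ : A^{(a)} → A'^{(b)}`:
`u_B(θ) := Base(frob_A)^* u_θ · u_{frob_A}^{deg θ} · (Base(r)^* u_{frob_{A'}})⁻¹ ∈ B(A_D)`.
[cite: MochizukiFrdI2008, Prop. 5.5 (iv) p.104] -/
noncomputable def unitB (hB : Objectwise (fun M _ => IsGroupLike M) B) (r : Rep X Y) : B.obj (op X.obj.base) :=
  pull B (ModelFrobenioid.baseMap (frob hF X.obj r.L.a)) (ModelFrobenioid.unit r.hom) *
      ModelFrobenioid.unit (frob hF X.obj r.L.a) ^ (ModelFrobenioid.degFr r.hom : ℕ) *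
    (hB X.obj.base).inv (pull B (Rep.mbase X Y r) (ModelFrobenioid.unit (frob hF Y.obj r.L.b)))

/-- The defining equation of `unitB`, cleared of the inverse.
[cite: MochizukiFrdI2008, Prop. 5.5 (iv) p.104] -/
theorem unitB_mul (r : Rep X Y) :
    unitB hB r * pull B (Rep.mbase X Y r) (ModelFrobenioid.unit (frob hF Y.obj r.L.b)) =
      pull B (ModelFrobenioid.baseMap (frob hF X.obj r.L.a)) (ModelFrobenioid.unit r.hom) *
        ModelFrobenioid.unit (frob hF X.obj r.L.a) ^ (ModelFrobenioid.degFr r.hom : ℕ) := by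
  rw [unitB, mul_assoc, IsGroupLike.inv_mul, mul_one]

/-- **The unit component `u^pf` of a representative**: the class `u_B(θ)^{1/(n·a)} ∈ B^pf(A_D)`.
[cite: MochizukiFrdI2008, Prop. 5.5 (iv) p.104] -/
noncomputable def unitPf (hB : Objectwise (fun M _ => IsGroupLike M) B) (r : Rep X Y) :
    Frobenioids.Perfection (B.obj (op X.obj.base)) :=
  Frobenioids.Perfection.mk (unitB hB r) (X.idx * r.L.a)

/-- Commutative-monoid bookkeeping for `unitB_lift`. [folklore] -/
private theorem unitB_lift_aux {M : Type w} [CommMonoid M] {A Bv U C Dθ W P : M} {d t : ℕ}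
    (usq : A * Bv ^ d = C * Dθ ^ t) (key : W * P = Dθ * U ^ d) :
    A * (Bv * U ^ t) ^ d = W ^ t * (C * P ^ t) := by
  calc A * (Bv * U ^ t) ^ d = (A * Bv ^ d) * U ^ (t * d) := by rw [mul_pow, ← pow_mul, mul_assoc]
    _ = (C * Dθ ^ t) * U ^ (t * d) := by rw [usq]
    _ = C * (Dθ * U ^ d) ^ t := by rw [mul_pow, ← pow_mul, mul_comm d t, mul_assoc]
    _ = C * (W * P) ^ t := by rw [key]
    _ = W ^ t * (C * P ^ t) := by rw [mul_pow, mul_left_comm]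

/-! ### Invariance under transport -/

/-- `unitB` of a transported representative is the corresponding power: transport to level `(a·t, b·t)` gives
`u_B(θ′) = u_B(θ)^t`. [cite: MochizukiFrdI2008, Prop. 5.5 (iv) p.104] -/
theorem unitB_lift (L L' : Level X Y) (h : L.LE L') (φ : L.HomAt) (t : ℕ+) (ht : L'.a = L.a * t) :
    unitB hB ⟨L', L.lift L' h φ⟩ = unitB hB ⟨L, φ⟩ ^ (t : ℕ) := by
  -- notation-free abbreviations
  have sq := L.lift_spec L' h φ
  have hdeg : (ModelFrobenioid.degFr (frobTrans hF Y.obj h.2) : ℕ) = t := by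
    have e : degFr (ModelFrobenioid.toElem Φ B DivB) (frobTrans hF Y.obj h.2) = t := by
      rw [← L.degFr_eq L' h]
      exact mul_left_cancel ((degFr_frobTrans hF X.obj h.1).trans ht)
    exact congrArg PNat.val e
  have hdegX : (ModelFrobenioid.degFr (frobTrans hF X.obj h.1) : ℕ) = t := by
    rw [← hdeg]
    exact congrArg PNat.val (L.degFr_eq L' h)
  have hdφ : ModelFrobenioid.degFr (L.lift L' h φ) = ModelFrobenioid.degFr φ :=
    degFr_frobeniusConjugate sq (L.degFr_eq L' h)
  -- the unit square of `frobTrans_X ≫ lift φ = φ ≫ frobTrans_Y`, pulled back to `A_D`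
  have usq := congrArg (pull B (ModelFrobenioid.baseMap (frob hF X.obj L.a))) (ModelFrobenioid.unit_square sq)
  rw [hdφ, hdeg, map_mul, map_mul, map_pow, map_pow] at usq
  -- clear the inverses on both sides
  have hb : Rep.mbase X Y ⟨L', L.lift L' h φ⟩ = Rep.mbase X Y ⟨L, φ⟩ := baseMap_lift L L' h φ
  apply (hB X.obj.base).mul_right_cancel
    (pull B (Rep.mbase X Y ⟨L', L.lift L' h φ⟩) (ModelFrobenioid.unit (frob hF Y.obj L'.b)))
  rw [unitB_mul]
  conv_rhs => rw [hb]
  -- expand `frob_{a t} = frob_a ≫ frobTrans_X`, `frob_{b t} = frob_b ≫ frobTrans_Y`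
  have eX : frob hF X.obj L'.a = frob hF X.obj L.a ≫ frobTrans hF X.obj h.1 := (frob_frobTrans hF X.obj h.1).symm
  have eY : frob hF Y.obj L'.b = frob hF Y.obj L.b ≫ frobTrans hF Y.obj h.2 := (frob_frobTrans hF Y.obj h.2).symm
  change pull B (ModelFrobenioid.baseMap (frob hF X.obj L'.a)) (ModelFrobenioid.unit (L.lift L' h φ)) *
      ModelFrobenioid.unit (frob hF X.obj L'.a) ^ (ModelFrobenioid.degFr (L.lift L' h φ) : ℕ) =
    unitB hB ⟨L, φ⟩ ^ (t : ℕ) * pull B (Rep.mbase X Y ⟨L, φ⟩) (ModelFrobenioid.unit (frob hF Y.obj L'.b))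
  rw [eX, eY, ModelFrobenioid.baseMap_comp, ModelFrobenioid.unit_comp_pull, ModelFrobenioid.unit_comp_pull,
    pull_comp, hdφ, hdeg, hdegX, map_mul, map_pow, pull_mbase_pull]
  -- use the cleared equation for `⟨L, φ⟩`
  have key := unitB_mul hB ⟨L, φ⟩
  exact unitB_lift_aux usq key

/-- `unitPf` is unchanged by transport. [cite: MochizukiFrdI2008, Prop. 5.5 (iv) p.104] -/
theorem unitPf_lift (L L' : Level X Y) (h : L.LE L') (φ : L.HomAt) :
    unitPf hB ⟨L', L.lift L' h φ⟩ = unitPf hB ⟨L, φ⟩ := by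
  obtain ⟨t, ht⟩ := h.1
  unfold unitPf
  dsimp only
  rw [unitB_lift hB L L' h φ t ht, ht, ← mul_assoc, Frobenioids.Perfection.mk_pow_mul]

/-- Representatives of the same perfected morphism have the same `unitPf`.
[cite: MochizukiFrdI2008, Prop. 5.5 (iv) p.104] -/
theorem unitPf_sound {r s : Rep X Y} (h : Agree r s) : unitPf hB r = unitPf hB s := by
  obtain ⟨M, hr, hs, e⟩ := h
  rw [← unitPf_lift hB r.L M hr r.hom, ← unitPf_lift hB s.L M hs s.hom, e]

/-- **The unit component `u^pf ∈ B^pf(A_D)` of a perfected morphism** of the model Frobenioid.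
[cite: MochizukiFrdI2008, Prop. 5.5 (iv) p.104] -/
noncomputable def Hom.unitPf (hB : Objectwise (fun M _ => IsGroupLike M) B) :
    (X ⟶ Y) → Frobenioids.Perfection (B.obj (op X.obj.base)) :=
  Quotient.lift (ModelPf.unitPf hB) fun _ _ h => unitPf_sound hB h

/-- `unitPf` on representatives. [cite: MochizukiFrdI2008, Prop. 5.5 (iv) p.104] -/
@[simp] theorem unitPf_mk (r : Rep X Y) : Hom.unitPf hB (Hom.mk r) = unitPf hB r := rfl

/-! ### The unit laws -/

/-- `u^pf(id) = 1`. [cite: MochizukiFrdI2008, Thm. 5.2 (i) p.100] -/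
theorem unitPf_id (X : Perfection hF) : Hom.unitPf hB (𝟙 X) = 1 := by
  rw [id_eq_mk, unitPf_mk]
  unfold unitPf unitB
  have hb : Rep.mbase X X (Rep.id X) = 𝟙 _ := by
    change Rep.baseMap (Rep.id X) = 𝟙 _
    rw [← baseMap_mk, ← id_eq_mk]
    exact baseMap_id X
  rw [hb]
  change Frobenioids.Perfection.mk
    (pull B (ModelFrobenioid.baseMap (frob hF X.obj 1)) (ModelFrobenioid.unit (𝟙 (frobPow hF X.obj 1))) *
        ModelFrobenioid.unit (frob hF X.obj 1) ^ ((ModelFrobenioid.degFr (𝟙 (frobPow hF X.obj 1))) : ℕ) *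
      (hB X.obj.base).inv (pull B (𝟙 _) (ModelFrobenioid.unit (frob hF X.obj 1)))) (X.idx * 1) = 1
  rw [ModelFrobenioid.unit_id, map_one, one_mul, ModelFrobenioid.degFr_id, PNat.one_coe, pow_one, pull_id,
    IsGroupLike.mul_inv, Frobenioids.Perfection.mk_one]

/-- The composition law for `unitB` at a common triple level `(a, b, c)`:
`u_B(φ ≫ ψ) = Base(r_φ)^* u_B(ψ) · u_B(φ)^{deg ψ}`. [cite: MochizukiFrdI2008, Thm. 5.2 (i) p.100] -/
theorem unitB_comp {a b c : ℕ+} (hab : X.idx * a = Y.idx * b) (hbc : Y.idx * b = Z.idx * c)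
    (φ : frobPow hF X.obj a ⟶ frobPow hF Y.obj b) (ψ : frobPow hF Y.obj b ⟶ frobPow hF Z.obj c) :
    unitB hB (⟨⟨a, c, hab.trans hbc⟩, φ ≫ ψ⟩ : Rep X Z) =
      pull B (Rep.mbase X Y ⟨⟨a, b, hab⟩, φ⟩) (unitB hB (⟨⟨b, c, hbc⟩, ψ⟩ : Rep Y Z)) *
        unitB hB (⟨⟨a, b, hab⟩, φ⟩ : Rep X Y) ^ (ModelFrobenioid.degFr ψ : ℕ) := by
  set rφ : Rep X Y := ⟨⟨a, b, hab⟩, φ⟩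
  set rψ : Rep Y Z := ⟨⟨b, c, hbc⟩, ψ⟩
  set rφψ : Rep X Z := ⟨⟨a, c, hab.trans hbc⟩, φ ≫ ψ⟩
  have hbase : Rep.mbase X Z rφψ = Rep.mbase X Y rφ ≫ Rep.mbase Y Z rψ := by
    have e := mk_compAt ⟨a, b, c, hab, hbc⟩ rφ rψ (Level.le_rfl _) (Level.le_rfl _)
    have h := baseMap_comp (X := X) (Y := Y) (Z := Z) (Hom.mk rφ) (Hom.mk rψ)
    rw [mk_comp_mk, ← e, baseMap_mk, baseMap_mk, baseMap_mk] at h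
    unfold compAt at h
    rw [Level.lift_rfl, Level.lift_rfl] at h
    exact h
  apply (hB X.obj.base).mul_right_cancel (pull B (Rep.mbase X Z rφψ) (ModelFrobenioid.unit (frob hF Z.obj c)))
  rw [unitB_mul]
  change pull B (ModelFrobenioid.baseMap (frob hF X.obj a)) (ModelFrobenioid.unit (φ ≫ ψ)) *
      ModelFrobenioid.unit (frob hF X.obj a) ^ (ModelFrobenioid.degFr (φ ≫ ψ) : ℕ) = _
  rw [ModelFrobenioid.unit_comp_pull, ModelFrobenioid.degFr_comp, map_mul, map_pow, hbase, pull_comp]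
  have kψ := unitB_mul hB rψ
  have kφ := unitB_mul hB rφ
  calc pull B (ModelFrobenioid.baseMap (frob hF X.obj a)) (pull B (ModelFrobenioid.baseMap φ) (ModelFrobenioid.unit ψ)) *
        pull B (ModelFrobenioid.baseMap (frob hF X.obj a)) (ModelFrobenioid.unit φ) ^ (ModelFrobenioid.degFr ψ : ℕ) *
        ModelFrobenioid.unit (frob hF X.obj a) ^ ((ModelFrobenioid.degFr ψ * ModelFrobenioid.degFr φ : ℕ+) : ℕ)
      = pull B (ModelFrobenioid.baseMap (frob hF X.obj a)) (pull B (ModelFrobenioid.baseMap φ) (ModelFrobenioid.unit ψ)) *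
          (pull B (ModelFrobenioid.baseMap (frob hF X.obj a)) (ModelFrobenioid.unit φ) *
            ModelFrobenioid.unit (frob hF X.obj a) ^ (ModelFrobenioid.degFr φ : ℕ)) ^ (ModelFrobenioid.degFr ψ : ℕ) := by
        rw [mul_pow, ← pow_mul, PNat.mul_coe, mul_comm (ModelFrobenioid.degFr φ : ℕ), mul_assoc]
    _ = pull B (Rep.mbase X Y rφ) (pull B (ModelFrobenioid.baseMap (frob hF Y.obj b)) (ModelFrobenioid.unit ψ)) *
          (unitB hB rφ * pull B (Rep.mbase X Y rφ) (ModelFrobenioid.unit (frob hF Y.obj b))) ^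
            (ModelFrobenioid.degFr ψ : ℕ) := by rw [← kφ, pull_mbase_pull]
    _ = pull B (Rep.mbase X Y rφ) (pull B (ModelFrobenioid.baseMap (frob hF Y.obj b)) (ModelFrobenioid.unit ψ) *
          ModelFrobenioid.unit (frob hF Y.obj b) ^ (ModelFrobenioid.degFr ψ : ℕ)) *
          unitB hB rφ ^ (ModelFrobenioid.degFr ψ : ℕ) := by
        rw [map_mul, map_pow, mul_pow]; ac_rfl
    _ = pull B (Rep.mbase X Y rφ) (unitB hB rψ * pull B (Rep.mbase Y Z rψ) (ModelFrobenioid.unit (frob hF Z.obj c))) *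
          unitB hB rφ ^ (ModelFrobenioid.degFr ψ : ℕ) := by rw [kψ]
    _ = _ := by rw [map_mul]; ac_rfl

/-- **The composition law for `u^pf`**: `u^pf(g ∘ f) = Base(f)^* u^pf(g) · u^pf(f)^{deg g}` in `B^pf(A_D)`
(the unit law of the model Frobenioid of the perfected data). [cite: MochizukiFrdI2008, Thm. 5.2 (i) p.100] -/
theorem unitPf_comp (f : X ⟶ Y) (g : Y ⟶ Z) :
    Hom.unitPf hB (f ≫ g) =
      Frobenioids.Perfection.map (pull B (Hom.mbase f)) (Hom.unitPf hB g) * Hom.unitPf hB f ^ (Hom.degFr g : ℕ) := by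
  obtain ⟨r, rfl⟩ := Hom.mk_surjective f
  obtain ⟨s, rfl⟩ := Hom.mk_surjective g
  change Hom.unitPf hB (Hom.mk r ≫ Hom.mk s) =
    Frobenioids.Perfection.map (pull B (Rep.mbase X Y r)) (unitPf hB s) * unitPf hB r ^ (Rep.degFr s : ℕ)
  have er := unitPf_lift hB r.L (Level₃.can r s).fst (Level₃.le_can_fst r s) r.hom
  have es := unitPf_lift hB s.L (Level₃.can r s).snd (Level₃.le_can_snd r s) s.hom
  have eb : Rep.mbase X Y ⟨(Level₃.can r s).fst, r.L.lift (Level₃.can r s).fst (Level₃.le_can_fst r s) r.hom⟩ =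
      Rep.mbase X Y r := baseMap_lift r.L _ (Level₃.le_can_fst r s) r.hom
  have ed : Rep.degFr ⟨(Level₃.can r s).snd, s.L.lift (Level₃.can r s).snd (Level₃.le_can_snd r s) s.hom⟩ = Rep.degFr s :=
    degFr_lift s.L _ (Level₃.le_can_snd r s) s.hom
  rw [mk_comp_mk, unitPf_mk, ← er, ← es, ← eb, ← ed]
  unfold Rep.comp compAt
  generalize r.L.lift (Level₃.can r s).fst (Level₃.le_can_fst r s) r.hom = φ
  generalize s.L.lift (Level₃.can r s).snd (Level₃.le_can_snd r s) s.hom = ψ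
  unfold unitPf Rep.degFr
  dsimp only
  rw [unitB_comp hB (Level₃.can r s).eq₁ (Level₃.can r s).eq₂ φ ψ, Frobenioids.Perfection.map_mk,
    Frobenioids.Perfection.mk_pow,
    show Y.idx * (r.L.b * s.L.a) = X.idx * (r.L.a * s.L.a) from (Level₃.can r s).eq₁.symm,
    Frobenioids.Perfection.mk_mul_mk, ← mul_pow, Frobenioids.Perfection.mk_pow_mul]
  rfl

end ModelPf

end Perfection

end PreFrobenioid

end Literature.AlgebraicGeometry.Frobenioids
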